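import Mathlib
import Summits.MatrixMultiplication.MatrixMultiplication.Theorems.SnSubsetDichotomyThresholdSubsetTriplesStubRhSwap
import Summits.MatrixMultiplication.MatrixMultiplication.Theorems.SnSubsetDichotomyThresholdSubsetTriplesStubRhOrbitSwap
import Summits.MatrixMultiplication.MatrixMultiplication.Theorems.SnSubsetDichotomyThresholdSubsetTriplesStubRhWalkup
import Summits.MatrixMultiplication.MatrixMultiplication.Theorems.SnSubsetDichotomyThresholdSubsetTriplesStubRh

/-!
# Riemann–Hurwitz inequality for permutation pairs (line `SketchIdeator6` of crux
`SnSubsetDichotomy.ThresholdSubsetTriples`, stmt-MatrixMultiplication-10882) — by-product `riemannHurwitz_perm`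

For permutations `σ, τ` of a finite type `α`,
`cyc σ + cyc τ + cyc (στ) ≤ |α| + 2·orb⟨σ,τ⟩`,
where `cyc π = Nat.card (MulAction.orbitRel.Quotient (Subgroup.zpowers π) α)` is the number of
cycles of `π` INCLUDING fixed points and `orb⟨σ,τ⟩` is the number of orbits of the subgroup generated by
`σ, τ`.  Equivalently: the 3-constellation `(σ, τ, (στ)⁻¹)` (a hypermap / bipartite map with `|α|`
edges) has non-negative genus on every connected component — the Euler–Poincaré / Riemann–Hurwitz
inequality of combinatorial map theory (Jacques 1968; Lando–Zvonkin 2004, Ch. 1; Gonthier's planar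
hypermap `Euler_le`).  Assembled from the four landed stubs of the lead skeleton:
`stub_rh (stub_rhWalkup stub_rhSwap stub_rhOrbitSwap)` (Walkup/point-deletion induction).
-/

namespace Summit.MatrixMultiplication.MatrixMultiplication.Theorems.ThresholdSubsetTriples

/-- **Riemann–Hurwitz inequality for permutation pairs** (genus of a 3-constellation is
non-negative): `cyc σ + cyc τ + cyc (σ * τ) ≤ Nat.card α + 2 · orb⟨σ, τ⟩` for all permutations
`σ, τ` of a finite type.  [cite: LandoZvonkin2004, Ch. 1] -/
theorem riemannHurwitz_perm : ∀ (α : Type) [Fintype α] (σ τ : Equiv.Perm α), Nat.card (MulAction.orbitRel.Quotient (Subgroup.zpowers σ) (α)) + Nat.card (MulAction.orbitRel.Quotient (Subgroup.zpowers τ) (α)) + Nat.card (MulAction.orbitRel.Quotient (Subgroup.zpowers (σ * τ)) (α)) ≤ Nat.card α + 2 * Nat.card (MulAction.orbitRel.Quotient (Subgroup.closure ({σ, τ} : Set (Equiv.Perm α))) (α)) :=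
  stub_rh (stub_rhWalkup stub_rhSwap stub_rhOrbitSwap)

end Summit.MatrixMultiplication.MatrixMultiplication.Theorems.ThresholdSubsetTriples
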